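import Summits.Ventures.PackingBounds.Configurations.DiploSimplexUnique
import Summits.Ventures.PackingBounds.Configurations.DiploSimplexEnergy

/-!
# Node-set configurations of the diplo-simplex type have the diplo-simplex energy (every potential, every `n ≥ 3`)

Framing: lottery ticket; floor = certified bounds/negative ranges. Venture `PackingBounds` (cell `pub-packcert`,
seat `pub-packcert-energy`, gen 25). Combines `DiploSimplexUnique.isometric_of_nodesets` (any two `(2n+2)`-point
configurations of unit vectors of `ℝⁿ` with inner products in `{-1, ±1/n}` are isometric) with the explicit
diplo-simplex `DiploSimplex.exists_config` (energy `(2n+2)(a(-1) + n a(-1/n) + n a(1/n))` for every potential `a`) and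
the invariance of pair-potential energies under linear isometries (`energy_image`): every such node-set configuration has
exactly that energy (`energy_eq_of_nodeset`). With a sharp three-point certificate whose Hermite node set is `{-1, ±1/n}`
this is the statement "every minimiser has the energy AND the geometry of the diplo-simplex".

## References
* B. Ballinger et al., Experiment. Math. 18 (2009) 257–283, §3.4. [`BallingerEtAl2009`]
-/

noncomputable section

open Finset
open scoped RealInnerProductSpace

namespace Summit.Ventures.PackingBounds.Config.DiploSimplexUnique

variable {n : ℕ}

/-- Pair-potential energies are invariant under linear isometries: the energy of `C.image Ψ` equals the energy of `C`. -/
theorem energy_image (C : Finset (EuclideanSpace ℝ (Fin n)))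
    (Ψ : EuclideanSpace ℝ (Fin n) ≃ₗᵢ[ℝ] EuclideanSpace ℝ (Fin n)) (a : ℝ → ℝ) :
    ∑ x ∈ C.image Ψ, ∑ y ∈ (C.image Ψ).erase x, a (inner ℝ x y) =
      ∑ x ∈ C, ∑ y ∈ C.erase x, a (inner ℝ x y) := by
  classical
  have hinj : Function.Injective Ψ := Ψ.injective
  rw [sum_image fun x _ y _ h => hinj h]
  refine sum_congr rfl fun x _ => ?_
  rw [← image_erase hinj, sum_image fun x _ y _ h => hinj h]
  refine sum_congr rfl fun y _ => ?_
  rw [LinearIsometryEquiv.inner_map_map]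

/-- **Energy of a node-set configuration.** If `X ⊂ ℝⁿ` (`n ≥ 3`) consists of `2n + 2` unit vectors with pairwise
inner products in `{-1, -1/n, 1/n}`, then for every potential `a`,
`Σ_{x ≠ y ∈ X} a(⟪x, y⟫) = (2n + 2) (a(-1) + n a(-1/n) + n a(1/n))` — the diplo-simplex energy.
[cite: BallingerEtAl2009, §3.4] -/
theorem energy_eq_of_nodeset (hn : 3 ≤ n) (X : Finset (EuclideanSpace ℝ (Fin n))) (h1 : ∀ x ∈ X, ‖x‖ = 1)
    (hcard : X.card = 2 * n + 2)
    (hZ : ∀ x ∈ X, ∀ y ∈ X, x ≠ y → inner ℝ x y = -1 ∨ inner ℝ x y = -1 / (n : ℝ) ∨ inner ℝ x y = 1 / (n : ℝ))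
    (a : ℝ → ℝ) :
    ∑ x ∈ X, ∑ y ∈ X.erase x, a (inner ℝ x y) =
      (2 * n + 2 : ℝ) * (a (-1) + n * a (-1 / (n : ℝ)) + n * a (1 / (n : ℝ))) := by
  classical
  obtain ⟨C, hCc, hC1, hCZ, hCe⟩ := DiploSimplex.exists_config n (le_trans (by norm_num) hn)
  obtain ⟨Ψ, hΨ⟩ := isometric_of_nodesets hn C X hC1 hCc hCZ h1 hcard hZ
  rw [hΨ, energy_image, hCe]

/-- In particular the Riesz-type / distance energies agree: `Σ_{x ≠ y ∈ X} g(‖x - y‖) = (2n+2)(g 2 + n g(√(2+2/n)) + n g(√(2-2/n)))`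
for every node-set configuration `X` as above. -/
theorem dist_energy_eq_of_nodeset (hn : 3 ≤ n) (X : Finset (EuclideanSpace ℝ (Fin n))) (h1 : ∀ x ∈ X, ‖x‖ = 1)
    (hcard : X.card = 2 * n + 2)
    (hZ : ∀ x ∈ X, ∀ y ∈ X, x ≠ y → inner ℝ x y = -1 ∨ inner ℝ x y = -1 / (n : ℝ) ∨ inner ℝ x y = 1 / (n : ℝ))
    (g : ℝ → ℝ) :
    ∑ x ∈ X, ∑ y ∈ X.erase x, g ‖x - y‖ =
      (2 * n + 2 : ℝ) * (g 2 + n * g (Real.sqrt (2 + 2 / (n : ℝ))) + n * g (Real.sqrt (2 - 2 / (n : ℝ)))) := by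
  have key := energy_eq_of_nodeset hn X h1 hcard hZ (fun t => g (Real.sqrt (2 - 2 * t)))
  beta_reduce at key
  have h4 : Real.sqrt (2 - 2 * (-1 : ℝ)) = 2 := by
    rw [show (2 : ℝ) - 2 * (-1) = 2 ^ 2 by norm_num, Real.sqrt_sq (by norm_num)]
  have hm : (2 : ℝ) - 2 * (-1 / (n : ℝ)) = 2 + 2 / (n : ℝ) := by ring
  have hp : (2 : ℝ) - 2 * (1 / (n : ℝ)) = 2 - 2 / (n : ℝ) := by ring
  rw [h4, hm, hp] at key
  rw [← key]
  exact sum_congr rfl fun x hx => sum_congr rfl fun y hy => by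
    rw [DiploSimplex.norm_sub_eq_sqrt (h1 x hx) (h1 y (mem_of_mem_erase hy))]

end Summit.Ventures.PackingBounds.Config.DiploSimplexUnique
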